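import Summits.CriticalPhenomena.PercolationContinuityZ3.Theorems.SahiAEBandGeometry

/-!
# The band theorem, gluing step: fibrewise trivialisation of the line-correction cocycles

Support file of the Sahi cell (`prim-sahi`, typer seat, generation 24; `--supports stmt-CriticalPhenomena-4575`).
Small definitions (`BandSeq`, `selQ`, `selIdx`, `corr`, `lineGlue`), theorems otherwise; no named facts, no sorries.

Setting: an open band `B ⊆ ℝ²` (`Plane.IsBand`), a measurable `φ` supermodular on almost every pair of `B`, and a dense
generic sequence of base points `c_n ∈ B` (`BandSeq`, from `exists_band_seq`).  The orthant versions above two base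
points differ on the common part of their arm boxes by `Λ₀(p₀) + Λ₁(p₁)` (`SahiAEBandShift.lean`), where the height
piece `Λ₀ = lineCorrection φ 0` only depends on the two heights and the abscissa piece `Λ₁` on the two abscissae, and

* along a vertical section of `B` the height pieces form an additive COCYCLE (`lineCorrection_add_band`: rational boxes
  around axis-parallel segments of `B`, `exists_sections_box`), vanishing almost everywhere
  (`ae_lineCorrection_eq_zero_band`);
* a band has no global base point, so the cocycle is trivialised FIBREWISE: `selIdx B c k p` is the first index whose
  section `(p; k := c_n k)` lies in `B` (a measurable selection, `Measurable.find`), and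
  `lineGlue B φ c i k m p = ±Λᵢ(c_m, c_{selIdx p})(p)` (`corr`, `lineGlue`);
* `lineGlue m − lineGlue m' = Λᵢ(c_m, c_{m'})` EXACTLY wherever both sections pass through `B`
  (`lineGlue_sub_lineGlue`, five order cases of the cocycle); `lineGlue` only depends on the other coordinate `pᵢ`
  (`lineGlue_eq_of_apply_eq`, horizontality of the line corrections) — hence it is modular — and vanishes almost
  everywhere (`ae_lineGlue_eq_zero`).

`SahiAEBand.lean` assembles the version.  No sorries, no new axioms.
-/

noncomputable section

namespace Summit.CriticalPhenomena.PercolationContinuityZ3.Theorems.SahiAEFourFunctions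

namespace Plane

open MeasureTheory Set Filter Topology Function
open scoped ENNReal NNReal

variable {B : Set (Fin 2 → ℝ)} {φ : (Fin 2 → ℝ) → ℝ} {c : ℕ → Fin 2 → ℝ}

/-! ### The data: a dense generic sequence of base points -/

/-- **A dense generic sequence of base points** of the band `B` for `φ` (as produced by `exists_band_seq`).
[this work] -/
structure BandSeq (B : Set (Fin 2 → ℝ)) (φ : (Fin 2 → ℝ) → ℝ) (c : ℕ → Fin 2 → ℝ) : Prop where
  mem : ∀ n, c n ∈ B
  dense : ∀ O : Set (Fin 2 → ℝ), IsOpen O → O.Nonempty → O ⊆ B → ∃ n, c n ∈ O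
  gen : ∀ n j, GenAt (patch φ j) (c n)
  pairGen : ∀ m n j, m ≠ n → PairGenAt (patch φ j) (c m) (c n)

/-- A dense generic sequence of base points exists for a non-empty open band. [this work] -/
theorem exists_bandSeq (hBo : IsOpen B) (hne : B.Nonempty) (hφ : Measurable φ) : ∃ c, BandSeq B φ c := by
  obtain ⟨c, h1, h2, h3, h4⟩ := exists_band_seq hBo hne hφ
  exact ⟨c, ⟨h1, h2, h3, h4⟩⟩

/-- In the plane, `l ≠ i` means `l` is the other index. [folklore] -/
theorem ne_iff_eq_other {i k : Fin 2} (hik : i ≠ k) {l : Fin 2} : l ≠ i ↔ l = k := by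
  fin_cases i <;> fin_cases k <;>
    fin_cases l <;> simp_all

/-- Updating the coordinate `k` only remembers the other coordinate. [folklore] -/
theorem update_eq_update_of_apply_eq {i k : Fin 2} (hik : i ≠ k) {p q : Fin 2 → ℝ} (h : p i = q i) (t : ℝ) :
    update p k t = update q k t :=
  update_eq_update_of_forall_ne (fun l hl => by
    have : l = i := by
      fin_cases i <;> fin_cases k <;>
        fin_cases l <;> simp_all
    rw [this, h]) t

/-! ### Sections through a point: rational boxes around axis-parallel segments -/

/-- **Axis sections inside rational boxes.**  If the points `(p; k := c_a k)` and `(p; k := c_e k)` lie in `B`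
(`c_e k ≤ c_a k`), then for some rational box `K_j` with a patch function and some radius `rₙ`, every point
`(d; i := s)` with `s ∈ (pᵢ − rₙ, pᵢ]` and `d_k ∈ [c_e k, c_a k]` lies in `K_j` (`i ≠ k`). [this work] -/
theorem exists_sections_box (hB : IsBand B) (hφ : Measurable φ)
    (hsmB : ∀ᵐ q ∂(volume : Measure (Fin 2 → ℝ)).prod volume,
      q.1 ∈ B → q.2 ∈ B → φ q.1 + φ q.2 ≤ φ (q.1 ⊓ q.2) + φ (q.1 ⊔ q.2))
    {i k : Fin 2} (hik : i ≠ k) {p : Fin 2 → ℝ} {lo hi : ℝ} (hle : lo ≤ hi)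
    (hlo : update p k lo ∈ B) (hhi : update p k hi ∈ B) :
    ∃ j : (Fin 2 → ℚ) × (Fin 2 → ℚ), ∃ n : ℕ, (∃ g, IsPatchFn φ j g) ∧
      ∀ s ∈ Ioc (p i - cornerRadius n) (p i), ∀ d : Fin 2 → ℝ, lo ≤ d k → d k ≤ hi →
        update d i s ∈ Icc (ratLo j) (ratHi j) := by
  have hxy : update p k lo ≤ update p k hi := fun l => by
    by_cases hl : l = k
    · subst hl; simp [hle]
    · simp [update_of_ne hl]
  have hseg : Icc (update p k lo) (update p k hi) ⊆ B := by
    refine hB.seg_subset _ hlo _ hhi hxy ?_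
    fin_cases k
    · right; simp
    · left; simp
  obtain ⟨j, hj, hjlo, hjhi⟩ := hB.exists_patch_box hφ hsmB hxy hseg
  have hgap : 0 < p i - ratLo j i := by
    have := hjlo i; rw [update_of_ne hik] at this; linarith
  obtain ⟨n, hn⟩ := (eventually_cornerRadius_lt hgap).exists
  refine ⟨j, n, hj, fun s hs d hd1 hd2 => ⟨fun l => ?_, fun l => ?_⟩⟩
  · by_cases hl : l = i
    · subst hl; rw [update_self]; have := hs.1; linarith
    · have hlk : l = k := (ne_iff_eq_other hik).1 hl
      subst hlk
      rw [update_of_ne hl]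
      have := hjlo l; rw [update_self] at this; linarith
  · by_cases hl : l = i
    · subst hl; rw [update_self]
      have := hjhi l; rw [update_of_ne hik] at this; linarith [hs.2]
    · have hlk : l = k := (ne_iff_eq_other hik).1 hl
      subst hlk
      rw [update_of_ne hl]
      have := hjhi l; rw [update_self] at this; linarith

/-- **The cocycle identity along a section of the band**: for three base points with coordinates `k` ordered
`c_e k < c_b k < c_a k` whose extreme sections through `p` lie in `B`,
`Λᵢ(c_a, c_e)(p) = Λᵢ(c_a, c_b)(p) + Λᵢ(c_b, c_e)(p)`. [this work] -/
theorem lineCorrection_add_band (hB : IsBand B) (hφ : Measurable φ)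
    (hsmB : ∀ᵐ q ∂(volume : Measure (Fin 2 → ℝ)).prod volume,
      q.1 ∈ B → q.2 ∈ B → φ q.1 + φ q.2 ≤ φ (q.1 ⊓ q.2) + φ (q.1 ⊔ q.2))
    (hc : BandSeq B φ c) {i k : Fin 2} (hik : i ≠ k) {a b e : ℕ} (hba : c b k < c a k) (heb : c e k < c b k)
    {p : Fin 2 → ℝ} (ha : update p k (c a k) ∈ B) (he : update p k (c e k) ∈ B) :
    lineCorrection φ i (c a) (c e) p = lineCorrection φ i (c a) (c b) p + lineCorrection φ i (c b) (c e) p := by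
  obtain ⟨j, n, hj, hK⟩ := exists_sections_box hB hφ hsmB hik (heb.trans hba).le he ha
  have hab : a ≠ b := fun h => by rw [h] at hba; exact lt_irrefl _ hba
  have hbe : b ≠ e := fun h => by rw [h] at heb; exact lt_irrefl _ heb
  refine lineCorrection_add hφ hj (fun l hl => ?_) (fun l hl => ?_) (hc.pairGen a b j hab) (hc.pairGen b e j hbe) n
    fun s hs => ⟨hK s hs (c a) (heb.trans hba).le le_rfl, hK s hs (c b) heb.le hba.le,
      hK s hs (c e) le_rfl (heb.trans hba).le⟩
  · rw [(ne_iff_eq_other hik).1 hl]; exact hba.le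
  · rw [(ne_iff_eq_other hik).1 hl]; exact heb.le

/-- **The line corrections vanish almost everywhere on the band**: for almost every `p`, `Λᵢ(c_a, c_e)(p) = 0`
whenever the two sections through `p` lie in `B` (`c_e k ≤ c_a k`, `a ≠ e`). [this work] -/
theorem ae_lineCorrection_eq_zero_band (hB : IsBand B) (hφ : Measurable φ)
    (hsmB : ∀ᵐ q ∂(volume : Measure (Fin 2 → ℝ)).prod volume,
      q.1 ∈ B → q.2 ∈ B → φ q.1 + φ q.2 ≤ φ (q.1 ⊓ q.2) + φ (q.1 ⊔ q.2))
    (hc : BandSeq B φ c) {i k : Fin 2} (hik : i ≠ k) :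
    ∀ᵐ p ∂(volume : Measure (Fin 2 → ℝ)), ∀ a e : ℕ, a ≠ e → c e k ≤ c a k →
      update p k (c a k) ∈ B → update p k (c e k) ∈ B → lineCorrection φ i (c a) (c e) p = 0 := by
  have H : ∀ (j : (Fin 2 → ℚ) × (Fin 2 → ℚ)) (a e : ℕ), ∀ᵐ p ∂(volume : Measure (Fin 2 → ℝ)),
      (∃ g, IsPatchFn φ j g) → a ≠ e → c e k ≤ c a k →
      (∃ n : ℕ, ∀ s ∈ Ioc (p i - cornerRadius n) (p i),
        update (c a) i s ∈ Icc (ratLo j) (ratHi j) ∧ update (c e) i s ∈ Icc (ratLo j) (ratHi j)) →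
      lineCorrection φ i (c a) (c e) p = 0 := by
    intro j a e
    by_cases hj : ∃ g, IsPatchFn φ j g
    · by_cases hae : a ≠ e
      · by_cases hle : c e k ≤ c a k
        · filter_upwards [lineCorrection_ae_eq_zero_of_patch hφ hj
            (fun l hl => by rw [(ne_iff_eq_other hik).1 hl]; exact hle) (hc.pairGen a e j hae)] with p hp _ _ _ hex
          exact hp hex
        · exact Eventually.of_forall fun _ _ _ h => absurd h hle
      · exact Eventually.of_forall fun _ _ h => absurd h hae
    · exact Eventually.of_forall fun _ h => absurd h hj
  have H' : ∀ᵐ p ∂(volume : Measure (Fin 2 → ℝ)), ∀ j a e, (∃ g, IsPatchFn φ j g) → a ≠ e → c e k ≤ c a k →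
      (∃ n : ℕ, ∀ s ∈ Ioc (p i - cornerRadius n) (p i),
        update (c a) i s ∈ Icc (ratLo j) (ratHi j) ∧ update (c e) i s ∈ Icc (ratLo j) (ratHi j)) →
      lineCorrection φ i (c a) (c e) p = 0 :=
    ae_all_iff.2 fun j => ae_all_iff.2 fun a => ae_all_iff.2 fun e => H j a e
  filter_upwards [H'] with p hp a e hae hle ha he
  obtain ⟨j, n, hj, hK⟩ := exists_sections_box hB hφ hsmB hik hle he ha
  exact hp j a e hj hae hle ⟨n, fun s hs => ⟨hK s hs (c a) hle le_rfl, hK s hs (c e) le_rfl hle⟩⟩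

/-! ### The fibrewise selection of a reference section -/

/-- The selection event: `p ∉ B`, or the section of `c_n` through `p` lies in `B`, or no section does.
[this work] -/
def selQ (B : Set (Fin 2 → ℝ)) (c : ℕ → Fin 2 → ℝ) (k : Fin 2) (n : ℕ) (p : Fin 2 → ℝ) : Prop :=
  p ∉ B ∨ update p k (c n k) ∈ B ∨ ∀ m, update p k (c m k) ∉ B

/-- The selection event happens for some index. [folklore] -/
theorem exists_selQ (B : Set (Fin 2 → ℝ)) (c : ℕ → Fin 2 → ℝ) (k : Fin 2) (p : Fin 2 → ℝ) : ∃ n, selQ B c k n p := by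
  by_cases h : ∃ m, update p k (c m k) ∈ B
  · obtain ⟨m, hm⟩ := h; exact ⟨m, Or.inr (Or.inl hm)⟩
  · push Not at h; exact ⟨0, Or.inr (Or.inr h)⟩

open Classical in
/-- **The reference index through `p` in direction `k`**: the first `n` with `(p; k := c_n k) ∈ B` (if any, for
`p ∈ B`). [this work] -/
def selIdx (B : Set (Fin 2 → ℝ)) (c : ℕ → Fin 2 → ℝ) (k : Fin 2) (p : Fin 2 → ℝ) : ℕ := Nat.find (exists_selQ B c k p)

/-- The selection events are measurable. [folklore] -/
theorem measurableSet_selQ (hBo : IsOpen B) (c : ℕ → Fin 2 → ℝ) (k : Fin 2) (n : ℕ) :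
    MeasurableSet {p | selQ B c k n p} := by
  have hm : ∀ m, MeasurableSet {p : Fin 2 → ℝ | update p k (c m k) ∈ B} := fun m =>
    (hBo.preimage (continuous_id.update k continuous_const)).measurableSet
  have e : {p | selQ B c k n p} = Bᶜ ∪ ({p | update p k (c n k) ∈ B} ∪ ⋂ m, {p | update p k (c m k) ∈ B}ᶜ) := by
    ext p; simp only [selQ, Set.mem_setOf_eq, Set.mem_union, Set.mem_compl_iff, Set.mem_iInter]
  rw [e]
  exact hBo.measurableSet.compl.union ((hm n).union (MeasurableSet.iInter fun m => (hm m).compl))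

/-- **The selected section lies in `B`** (for `p ∈ B`, given a dense sequence). [this work] -/
theorem update_selIdx_mem (hB : IsBand B) (hc : BandSeq B φ c) (k : Fin 2) {p : Fin 2 → ℝ} (hp : p ∈ B) :
    update p k (c (selIdx B c k p) k) ∈ B := by
  classical
  have hex : ∃ m, update p k (c m k) ∈ B := by
    obtain ⟨m, hm⟩ := hc.dense (B ∩ {x | update p k (x k) ∈ B})
      (hB.isOpen.inter (hB.isOpen.preimage (continuous_const.update k (continuous_apply k))))
      ⟨p, hp, by simpa using hp⟩ Set.inter_subset_left
    exact ⟨m, hm.2⟩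
  have hspec : selQ B c k (selIdx B c k p) p := Nat.find_spec (exists_selQ B c k p)
  rcases hspec with h | h | h
  · exact absurd hp h
  · exact h
  · obtain ⟨m, hm⟩ := hex; exact absurd hm (h m)

/-- **The selection only depends on the other coordinate** (`p, q ∈ B`, `pᵢ = qᵢ`, `i ≠ k`). [this work] -/
theorem selIdx_eq_of_apply_eq {i k : Fin 2} (hik : i ≠ k) {p q : Fin 2 → ℝ} (hp : p ∈ B) (hq : q ∈ B) (h : p i = q i) :
    selIdx B c k p = selIdx B c k q := by
  classical
  have hiff : ∀ n, selQ B c k n p ↔ selQ B c k n q := fun n => by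
    simp only [selQ, update_eq_update_of_apply_eq hik h, hp, hq, not_true_eq_false, false_or]
  apply le_antisymm
  · exact Nat.find_min' _ ((hiff _).2 (Nat.find_spec (exists_selQ B c k q)))
  · exact Nat.find_min' _ ((hiff _).1 (Nat.find_spec (exists_selQ B c k p)))

/-! ### The glued line corrections -/

/-- The signed line correction between the base points `c_m` and `c_n` (zero if their `k`-th coordinates agree).
[this work] -/
def corr (φ : (Fin 2 → ℝ) → ℝ) (c : ℕ → Fin 2 → ℝ) (i k : Fin 2) (m n : ℕ) (p : Fin 2 → ℝ) : ℝ :=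
  if c n k < c m k then lineCorrection φ i (c m) (c n) p
  else if c m k < c n k then -lineCorrection φ i (c n) (c m) p else 0

/-- **The glued line correction** attached to the base point `c_m`: the signed line correction between `c_m` and
the reference base point through `p`. [this work] -/
def lineGlue (B : Set (Fin 2 → ℝ)) (φ : (Fin 2 → ℝ) → ℝ) (c : ℕ → Fin 2 → ℝ) (i k : Fin 2) (m : ℕ)
    (p : Fin 2 → ℝ) : ℝ :=
  corr φ c i k m (selIdx B c k p) p

/-- The signed corrections are measurable. [folklore] -/
theorem measurable_corr (hφ : Measurable φ) (c : ℕ → Fin 2 → ℝ) (i k : Fin 2) (m n : ℕ) :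
    Measurable (corr φ c i k m n) := by
  by_cases h1 : c n k < c m k
  · have e : corr φ c i k m n = lineCorrection φ i (c m) (c n) := by funext p; simp [corr, h1]
    rw [e]; exact measurable_lineCorrection hφ i _ _
  · by_cases h2 : c m k < c n k
    · have e : corr φ c i k m n = fun p => -lineCorrection φ i (c n) (c m) p := by funext p; simp [corr, h1, h2]
      rw [e]; exact (measurable_lineCorrection hφ i _ _).neg
    · have e : corr φ c i k m n = fun _ => 0 := by funext p; simp [corr, h1, h2]
      rw [e]; exact measurable_const

/-- **The glued line corrections are measurable** (`Measurable.find`). [this work] -/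
theorem measurable_lineGlue (hBo : IsOpen B) (hφ : Measurable φ) (c : ℕ → Fin 2 → ℝ) (i k : Fin 2) (m : ℕ) :
    Measurable (lineGlue B φ c i k m) := by
  classical
  exact Measurable.find (fun n => measurable_corr hφ c i k m n) (fun n => measurableSet_selQ hBo c k n)
    (exists_selQ B c k)

/-- The signed correction only depends on `pᵢ`. [folklore] -/
theorem corr_eq_of_apply_eq (hφ : Measurable φ) {i k : Fin 2} {m n : ℕ} {p q : Fin 2 → ℝ} (h : p i = q i) :
    corr φ c i k m n p = corr φ c i k m n q := by
  simp only [corr, lineCorrection_eq_of_apply_eq hφ h (c := c m) (c' := c n),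
    lineCorrection_eq_of_apply_eq hφ h (c := c n) (c' := c m)]

/-- **The glued line correction only depends on `pᵢ`** (on `B`). [this work] -/
theorem lineGlue_eq_of_apply_eq (hφ : Measurable φ) {i k : Fin 2} (hik : i ≠ k) {m : ℕ} {p q : Fin 2 → ℝ}
    (hp : p ∈ B) (hq : q ∈ B) (h : p i = q i) : lineGlue B φ c i k m p = lineGlue B φ c i k m q := by
  simp only [lineGlue]
  rw [selIdx_eq_of_apply_eq hik hp hq h, corr_eq_of_apply_eq hφ h]

/-- Same-coordinate base points give the same line corrections. [folklore] -/
theorem lineCorrection_congr_seq {i k : Fin 2} (hik : i ≠ k) {a b e : ℕ} :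
    (c a k = c b k → lineCorrection φ i (c a) (c e) = lineCorrection φ i (c b) (c e)) ∧
    (c a k = c b k → lineCorrection φ i (c e) (c a) = lineCorrection φ i (c e) (c b)) :=
  ⟨fun h => lineCorrection_congr_base (fun l hl => by rw [(ne_iff_eq_other hik).1 hl, h]) (fun _ _ => rfl),
    fun h => lineCorrection_congr_base (fun _ _ => rfl) (fun l hl => by rw [(ne_iff_eq_other hik).1 hl, h])⟩

/-- **The glued corrections trivialise the cocycle**: `lineGlue m − lineGlue m' = Λᵢ(c_m, c_{m'})` at every
`p ∈ B` through which the sections of `c_m` and `c_{m'}` pass, `c_{m'} k < c_m k` (five order cases of the cocycle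
identity `lineCorrection_add_band`). [this work] -/
theorem lineGlue_sub_lineGlue (hB : IsBand B) (hφ : Measurable φ)
    (hsmB : ∀ᵐ q ∂(volume : Measure (Fin 2 → ℝ)).prod volume,
      q.1 ∈ B → q.2 ∈ B → φ q.1 + φ q.2 ≤ φ (q.1 ⊓ q.2) + φ (q.1 ⊔ q.2))
    (hc : BandSeq B φ c) {i k : Fin 2} (hik : i ≠ k) {m m' : ℕ} {p : Fin 2 → ℝ} (hp : p ∈ B)
    (hm : update p k (c m k) ∈ B) (hm' : update p k (c m' k) ∈ B) (hlt : c m' k < c m k) :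
    lineGlue B φ c i k m p - lineGlue B φ c i k m' p = lineCorrection φ i (c m) (c m') p := by
  set n := selIdx B c k p with hn
  have hnB : update p k (c n k) ∈ B := update_selIdx_mem hB hc k hp
  simp only [lineGlue, ← hn, corr]
  rcases lt_trichotomy (c n k) (c m' k) with h1 | h1 | h1
  · -- `c_n k < c_{m'} k < c_m k`
    rw [if_pos (h1.trans hlt), if_pos h1, lineCorrection_add_band hB hφ hsmB hc hik hlt h1 hm hnB]
    ring
  · -- `c_n k = c_{m'} k`
    rw [if_pos (h1.symm ▸ hlt), if_neg (h1 ▸ lt_irrefl _), if_neg (h1 ▸ lt_irrefl _),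
      (lineCorrection_congr_seq (φ := φ) (c := c) hik (e := m)).2 h1]
    ring
  · rcases lt_trichotomy (c n k) (c m k) with h2 | h2 | h2
    · -- `c_{m'} k < c_n k < c_m k`
      rw [if_pos h2, if_neg (not_lt.2 h1.le), if_pos h1, lineCorrection_add_band hB hφ hsmB hc hik h2 h1 hm hm']
      ring
    · -- `c_n k = c_m k`
      rw [if_neg (h2 ▸ lt_irrefl _), if_neg (h2 ▸ lt_irrefl _), if_neg (not_lt.2 h1.le), if_pos h1,
        (lineCorrection_congr_seq (φ := φ) (c := c) hik (e := m')).1 h2]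
      ring
    · -- `c_m k < c_n k`
      rw [if_neg (not_lt.2 h2.le), if_pos h2, if_neg (not_lt.2 h1.le), if_pos h1,
        lineCorrection_add_band hB hφ hsmB hc hik h2 hlt hnB hm']
      ring

/-- **The glued line corrections vanish almost everywhere on the band.** [this work] -/
theorem ae_lineGlue_eq_zero (hB : IsBand B) (hφ : Measurable φ)
    (hsmB : ∀ᵐ q ∂(volume : Measure (Fin 2 → ℝ)).prod volume,
      q.1 ∈ B → q.2 ∈ B → φ q.1 + φ q.2 ≤ φ (q.1 ⊓ q.2) + φ (q.1 ⊔ q.2))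
    (hc : BandSeq B φ c) {i k : Fin 2} (hik : i ≠ k) (m : ℕ) :
    ∀ᵐ p ∂(volume : Measure (Fin 2 → ℝ)), p ∈ B → update p k (c m k) ∈ B → lineGlue B φ c i k m p = 0 := by
  filter_upwards [ae_lineCorrection_eq_zero_band hB hφ hsmB hc hik] with p hp hpB hm
  set n := selIdx B c k p with hn
  have hnB : update p k (c n k) ∈ B := update_selIdx_mem hB hc k hpB
  simp only [lineGlue, ← hn, corr]
  by_cases h1 : c n k < c m k
  · rw [if_pos h1]
    exact hp m n (fun h => by rw [h] at h1; exact lt_irrefl _ h1) h1.le hm hnB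
  · rw [if_neg h1]
    by_cases h2 : c m k < c n k
    · rw [if_pos h2, hp n m (fun h => by rw [h] at h2; exact lt_irrefl _ h2) h2.le hnB hm, neg_zero]
    · rw [if_neg h2]

end Plane

end Summit.CriticalPhenomena.PercolationContinuityZ3.Theorems.SahiAEFourFunctions
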